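import Mathlib.Analysis.Calculus.LocalExtr.Basic
import Summits.QuantumFields.YangMills.Theorems.FluctuationComparisonRegPrIntLOrganTangentLawSquareResponse
import HarnessLib

/-!
# Crux `FluctuationComparisonRegPrIntL` (stmt-QuantumFields-20520, rung R3), PATH-B organ, H-currency cone — (L27a) «`_of_lip` EDITIONS» of the law-response engine
# (✓(L23a) p815758, ✓(L24) p816100): LIPSCHITZ-in-the-parameter density families, differentiable at each parameter point for a.e. fibre point (TN-CUT-KINK), Mathlib-only

Cell `ym3-torus` (YM ladder rung R3 = continuum `SU(2)` Yang–Mills on the three-torus — a RUNG: NOT d = 4, NOT infinite volume, NOT a mass gap, NOT Clay).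
Width seat `ym-ust-20520-w5` (gen 24), `--supports stmt-QuantumFields-20520 --as helper`, count-neutral, no registry ∕ binder ∕ `Lines/` edit, DEFINITION-FREE,
default heartbeats.  Mathlib `hasDerivAt_integral_of_dominated_loc_of_lip`, `IsLocalMin.hasDerivAt_eq_zero` + the algebra of ✓(L23a)∕✓(L24) (imports ✓p816100 only).

WHY (TN-CUT-KINK, w5 g24 08:08Z; LEAD w3 g26 №30 «the row states path regularity as (Lip) + a.e. `HasDerivAt`, never C¹»).  The organ's fibre weights `wNum = χ·ρ^t·ρ′^{1−t}·J` carry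
the FROZEN soft cut `χ = ∏ max 0 (min 1 (…))`, which is only LIPSCHITZ along a coarse bond move: for a positive-measure set of fibre points the orbit crosses a kink at SOME
parameter, so ✓(L23a)'s binder «a.e. `z`, `HasDerivAt` at EVERY `s` near `s₀`» (Mathlib `…_of_deriv_le`) is not dischargeable there, while «a.e.-`z` LIPSCHITZ in `s` on a
neighbourhood + `HasDerivAt` AT `s₀` for a.e. `z`» (Mathlib `…_of_lip`) is (a kink crossing at a FIXED parameter is a null event).  This file re-issues the engine with those
binders; conclusions are UNCHANGED, so the algebraic identities of the `C¹` editions (`normMean_deriv_eq_cov(_of_null)`, `integral_centred_*`, `normCov_deriv_eq_cum3_of_null`,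
`nForm_eq_cum3_add_cov`) apply verbatim.
* §0 `deriv_eq_zero_of_nonneg_of_eq_zero` ∕ ★`cut_null_of_nonneg` — for a NON-NEGATIVE family the cut clause «`w′ = 0` where `w = 0`» is AUTOMATIC at every point of
  differentiability (interior minimum) — so the `_of_lip` bricks need no cut binder, only `0 ≤ wNum` (✓`OrganTangentFibreWeightNormalisation.wNum_nonneg`).
  `lipschitzOnWith_const_mul_nnabs` — knit helper: `s ↦ c·f s` is Lipschitz with constant `Real.nnabs (c·b)` if `f` is with `Real.nnabs b`.
* §1 `hasDerivAt_integral_family_of_lip`, `hasDerivAt_integral_mul_family_of_lip`, ★`hasDerivAt_normMean_of_lip`, ★`hasDerivAt_normCov_of_lip` (at `s₀`; binders: `S ∈ 𝓝 s₀`,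
  measurability, integrability at `s₀`, a.e.-`z` `LipschitzOnWith (nnabs (b z)) (s ↦ w s z) S` for `w` and for each frozen product `G·w` with integrable constants, and
  `∀ᵐ z, HasDerivAt (s ↦ w s z) (w′₀ z) s₀`).
* §2 ★★`abs_normMean_one_sub_zero_le_of_lip`, ★★`abs_normCov_one_sub_zero_le_of_lip` — the `[0,1]` law-EDGE forms (Lipschitz on an open `U ⊇ [0,1]`; differentiability
  `∀ s ∈ [0,1], ∀ᵐ z, HasDerivAt … (w′ s z) s`).
* §3 ★★`abs_normMean_secondDiff_le_of_lip` — the law SQUARE WITHOUT a mixed derivative (a Lipschitz cut has none under the integral sign: the second response carries a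
  kink-surface term): `g(s) := E_{(s,1)}[G] − E_{(s,0)}[G]`, `|ΔΔ_{[0,1]²} E[G]| = |g 1 − g 0| ≤ sup_s |g′(s)|` with `g′(s) = D(s,1) − D(s,0)`, `D(s,s′)` the FIRST `s`-response at
  `(s,s′)` — so the kernel binder is the `s′`-EDGE DIFFERENCE of the `s`-score covariance, `∀ s ∈ [0,1], |D(s,1) − D(s,0)| ≤ ℓ` (first-order data in `s` at `s′ ∈ [0,1]` only);
  ★★`abs_normVar_secondDiff_le_of_lip` — the variance square likewise: `g(s) = (ψ − φ²)(s,1) − (ψ − φ²)(s,0)`, kernel `|(Dψ − 2φ·Dφ)(s,1) − (Dψ − 2φ·Dφ)(s,0)| ≤ ℓ`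
  (`Dψ − 2φ·Dφ = Cov_own((F − E F)², r)` in score language).

HONEST FRAMING: generic plumbing [folklore]; no letter is priced, no cumulant bounded; nothing of Bałaban's analysis is asserted or proved; `SpreadFibreLawH` ∕ `SpreadFibreLawHJ` are
HYPOTHESIS rows; LIN″ ∕ JVAR″ ∕ JEN″ ∕ O1ᵘ-H v2.2 ∕ S1aᴴ ∕ S3ᴴ ∕ S2α′ ∕ S2β, the five registered stubs of `Lines/semiclassical_s2beta.lean`, crux 20520 `FluctuationComparisonRegPrIntL` and
`YM3TorusSU2` are NOT proved; registry untouched; rung R3 = SU(2) YM₃ on T³ at fixed lattice data — NOT d = 4, NOT infinite volume, NOT a mass gap, NOT Clay; the Yang–Mills mass gap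
is NOT proved.  [folklore].
-/

set_option autoImplicit false

noncomputable section

namespace Summit.QuantumFields.YangMills.Theorems.OrganTangentLawResponseLip

open MeasureTheory Filter Topology Set
open scoped ENNReal
open Summit.QuantumFields.YangMills.Theorems.OrganTangentLawEdgeResponse
open Summit.QuantumFields.YangMills.Theorems.OrganTangentLawSquareResponse

variable {Z : Type*} [MeasurableSpace Z] {τ : Measure Z}

/-! ## §0 The cut clause is automatic for non-negative families -/

/-- A non-negative real function vanishing at `s₀` and differentiable there has derivative `0` (interior minimum). [folklore] -/
theorem deriv_eq_zero_of_nonneg_of_eq_zero {f : ℝ → ℝ} {d s₀ : ℝ} (hf : ∀ s, 0 ≤ f s) (h0 : f s₀ = 0) (hd : HasDerivAt f d s₀) : d = 0 :=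
  IsLocalMin.hasDerivAt_eq_zero (Filter.Eventually.of_forall fun s => by rw [h0]; exact hf s) hd

/-- ★ CUT CLAUSE FROM NON-NEGATIVITY: for a family `w ≥ 0` with `∀ᵐ z, HasDerivAt (s ↦ w s z) (w′₀ z) s₀`, a.e. `w s₀ z = 0 → w′₀ z = 0` — the hypothesis of ✓(L24)
`normMean_deriv_eq_cov_of_null` ∕ ✓(L26a) `normCov_deriv_eq_cum3_of_null`, discharged. [folklore] -/
theorem cut_null_of_nonneg {w : ℝ → Z → ℝ} {w'₀ : Z → ℝ} {s₀ : ℝ} (hw0 : ∀ s z, 0 ≤ w s z)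
    (hd : ∀ᵐ z ∂τ, HasDerivAt (fun s => w s z) (w'₀ z) s₀) : ∀ᵐ z ∂τ, w s₀ z = 0 → w'₀ z = 0 := by
  filter_upwards [hd] with z hz h0
  exact deriv_eq_zero_of_nonneg_of_eq_zero (f := fun s => w s z) (fun s => hw0 s z) h0 hz

/-- KNIT HELPER: a frozen real factor `c` times a Lipschitz-in-`s` family is Lipschitz with constant `|c|·|b|` — in the `Real.nnabs` format of the `_of_lip` binders (so a knit can
derive the product clauses `s ↦ G z·w s z` from ONE weight clause and a pointwise bound on the frozen factor where needed). [folklore] -/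
theorem lipschitzOnWith_const_mul_nnabs {f : ℝ → ℝ} {b : ℝ} {S : Set ℝ} (c : ℝ) (h : LipschitzOnWith (Real.nnabs b) f S) :
    LipschitzOnWith (Real.nnabs (c * b)) (fun s => c * f s) S := by
  rw [lipschitzOnWith_iff_dist_le_mul] at h ⊢
  intro x hx y hy
  have hxy := h x hx y hy
  rw [Real.dist_eq] at hxy ⊢
  rw [← mul_sub, abs_mul]
  have e1 : ((Real.nnabs b : NNReal) : ℝ) = |b| := Real.coe_nnabs b
  have e2 : ((Real.nnabs (c * b) : NNReal) : ℝ) = |c| * |b| := by rw [Real.coe_nnabs, abs_mul]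
  rw [e1] at hxy
  rw [e2, mul_assoc]
  exact mul_le_mul_of_nonneg_left hxy (abs_nonneg c)

/-! ## §1 Dominated differentiation, Lipschitz edition; the law response at a point -/

/-- `d∕ds ∫ w_s dτ = ∫ w′₀ dτ` at `s₀` (Mathlib `hasDerivAt_integral_of_dominated_loc_of_lip`). [folklore] -/
theorem hasDerivAt_integral_family_of_lip {w : ℝ → Z → ℝ} {w'₀ : Z → ℝ} {s₀ : ℝ} {S : Set ℝ} (hS : S ∈ 𝓝 s₀)
    (hmeas : ∀ s, AEStronglyMeasurable (w s) τ) (hint : Integrable (w s₀) τ) (hmeas' : AEStronglyMeasurable w'₀ τ)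
    {bound : Z → ℝ} (hlip : ∀ᵐ z ∂τ, LipschitzOnWith (Real.nnabs (bound z)) (fun s => w s z) S) (hbint : Integrable bound τ)
    (hdiff : ∀ᵐ z ∂τ, HasDerivAt (fun s => w s z) (w'₀ z) s₀) :
    HasDerivAt (fun s => ∫ z, w s z ∂τ) (∫ z, w'₀ z ∂τ) s₀ :=
  (hasDerivAt_integral_of_dominated_loc_of_lip (μ := τ) (F := w) (F' := w'₀) (bound := bound) hS (Eventually.of_forall hmeas) hint hmeas'
    hlip hbint hdiff).2

/-- Same with a frozen factor `G` (its own Lipschitz binder for `s ↦ G·w s`). [folklore] -/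
theorem hasDerivAt_integral_mul_family_of_lip {w : ℝ → Z → ℝ} {w'₀ : Z → ℝ} {G : Z → ℝ} {s₀ : ℝ} {S : Set ℝ} (hS : S ∈ 𝓝 s₀)
    (hG : AEStronglyMeasurable G τ) (hmeas : ∀ s, AEStronglyMeasurable (w s) τ)
    (hintG : Integrable (fun z => G z * w s₀ z) τ) (hmeas' : AEStronglyMeasurable w'₀ τ)
    {boundG : Z → ℝ} (hlipG : ∀ᵐ z ∂τ, LipschitzOnWith (Real.nnabs (boundG z)) (fun s => G z * w s z) S) (hbGint : Integrable boundG τ)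
    (hdiff : ∀ᵐ z ∂τ, HasDerivAt (fun s => w s z) (w'₀ z) s₀) :
    HasDerivAt (fun s => ∫ z, G z * w s z ∂τ) (∫ z, G z * w'₀ z ∂τ) s₀ := by
  refine (hasDerivAt_integral_of_dominated_loc_of_lip (μ := τ) (F := fun s z => G z * w s z) (F' := fun z => G z * w'₀ z) (bound := boundG) hS
    (Eventually.of_forall fun s => hG.mul (hmeas s)) hintG (hG.mul hmeas') hlipG hbGint ?_).2
  filter_upwards [hdiff] with z hz
  exact hz.const_mul (G z)

/-- ★ **THE LAW RESPONSE OF A FROZEN-INTEGRAND MEAN, LIPSCHITZ EDITION** (same value as ✓(L23a) `hasDerivAt_normMean`). [folklore] -/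
theorem hasDerivAt_normMean_of_lip {w : ℝ → Z → ℝ} {w'₀ : Z → ℝ} {G : Z → ℝ} {s₀ : ℝ} {S : Set ℝ} (hS : S ∈ 𝓝 s₀)
    (hG : AEStronglyMeasurable G τ) (hmeas : ∀ s, AEStronglyMeasurable (w s) τ)
    (hint : Integrable (w s₀) τ) (hintG : Integrable (fun z => G z * w s₀ z) τ) (hmeas' : AEStronglyMeasurable w'₀ τ)
    {bound : Z → ℝ} (hlip : ∀ᵐ z ∂τ, LipschitzOnWith (Real.nnabs (bound z)) (fun s => w s z) S) (hbint : Integrable bound τ)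
    {boundG : Z → ℝ} (hlipG : ∀ᵐ z ∂τ, LipschitzOnWith (Real.nnabs (boundG z)) (fun s => G z * w s z) S) (hbGint : Integrable boundG τ)
    (hdiff : ∀ᵐ z ∂τ, HasDerivAt (fun s => w s z) (w'₀ z) s₀) (hZ : ∫ z, w s₀ z ∂τ ≠ 0) :
    HasDerivAt (fun s => (∫ z, G z * w s z ∂τ) / (∫ z, w s z ∂τ))
      ((∫ z, G z * w'₀ z ∂τ) / (∫ z, w s₀ z ∂τ) - ((∫ z, G z * w s₀ z ∂τ) / (∫ z, w s₀ z ∂τ)) * ((∫ z, w'₀ z ∂τ) / (∫ z, w s₀ z ∂τ))) s₀ :=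
  hasDerivAt_div_normForm (hasDerivAt_integral_mul_family_of_lip hS hG hmeas hintG hmeas' hlipG hbGint hdiff)
    (hasDerivAt_integral_family_of_lip hS hmeas hint hmeas' hlip hbint hdiff) hZ

/-- ★ **THE LAW RESPONSE OF A COVARIANCE, LIPSCHITZ EDITION** (same value as ✓(L23a) `hasDerivAt_normCov`). [folklore] -/
theorem hasDerivAt_normCov_of_lip {w : ℝ → Z → ℝ} {w'₀ : Z → ℝ} {A B : Z → ℝ} {s₀ : ℝ} {S : Set ℝ} (hS : S ∈ 𝓝 s₀)
    (hA : AEStronglyMeasurable A τ) (hB : AEStronglyMeasurable B τ) (hmeas : ∀ s, AEStronglyMeasurable (w s) τ)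
    (hint : Integrable (w s₀) τ) (hintA : Integrable (fun z => A z * w s₀ z) τ) (hintB : Integrable (fun z => B z * w s₀ z) τ)
    (hintAB : Integrable (fun z => (A z * B z) * w s₀ z) τ) (hmeas' : AEStronglyMeasurable w'₀ τ)
    {bound : Z → ℝ} (hlip : ∀ᵐ z ∂τ, LipschitzOnWith (Real.nnabs (bound z)) (fun s => w s z) S) (hbint : Integrable bound τ)
    {boundA : Z → ℝ} (hlipA : ∀ᵐ z ∂τ, LipschitzOnWith (Real.nnabs (boundA z)) (fun s => A z * w s z) S) (hbAint : Integrable boundA τ)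
    {boundB : Z → ℝ} (hlipB : ∀ᵐ z ∂τ, LipschitzOnWith (Real.nnabs (boundB z)) (fun s => B z * w s z) S) (hbBint : Integrable boundB τ)
    {boundAB : Z → ℝ} (hlipAB : ∀ᵐ z ∂τ, LipschitzOnWith (Real.nnabs (boundAB z)) (fun s => (A z * B z) * w s z) S) (hbABint : Integrable boundAB τ)
    (hdiff : ∀ᵐ z ∂τ, HasDerivAt (fun s => w s z) (w'₀ z) s₀) (hZ : ∫ z, w s₀ z ∂τ ≠ 0) :
    HasDerivAt (fun s => (∫ z, (A z * B z) * w s z ∂τ) / (∫ z, w s z ∂τ)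
        - ((∫ z, A z * w s z ∂τ) / (∫ z, w s z ∂τ)) * ((∫ z, B z * w s z ∂τ) / (∫ z, w s z ∂τ)))
      (((∫ z, (A z * B z) * w'₀ z ∂τ) / (∫ z, w s₀ z ∂τ)
          - ((∫ z, (A z * B z) * w s₀ z ∂τ) / (∫ z, w s₀ z ∂τ)) * ((∫ z, w'₀ z ∂τ) / (∫ z, w s₀ z ∂τ)))
        - (((∫ z, A z * w'₀ z ∂τ) / (∫ z, w s₀ z ∂τ)
              - ((∫ z, A z * w s₀ z ∂τ) / (∫ z, w s₀ z ∂τ)) * ((∫ z, w'₀ z ∂τ) / (∫ z, w s₀ z ∂τ)))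
            * ((∫ z, B z * w s₀ z ∂τ) / (∫ z, w s₀ z ∂τ))
          + ((∫ z, A z * w s₀ z ∂τ) / (∫ z, w s₀ z ∂τ))
            * ((∫ z, B z * w'₀ z ∂τ) / (∫ z, w s₀ z ∂τ)
              - ((∫ z, B z * w s₀ z ∂τ) / (∫ z, w s₀ z ∂τ)) * ((∫ z, w'₀ z ∂τ) / (∫ z, w s₀ z ∂τ))))) s₀ :=
  hasDerivAt_sub_mul
    (hasDerivAt_normMean_of_lip hS (hA.mul hB) hmeas hint hintAB hmeas' hlip hbint hlipAB hbABint hdiff hZ)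
    (hasDerivAt_normMean_of_lip hS hA hmeas hint hintA hmeas' hlip hbint hlipA hbAint hdiff hZ)
    (hasDerivAt_normMean_of_lip hS hB hmeas hint hintB hmeas' hlip hbint hlipB hbBint hdiff hZ)

/-! ## §2 The `[0,1]` law edge, Lipschitz edition -/

/-- ★★ **LAW EDGE OF A FROZEN-INTEGRAND MEAN ≤ sup PATH COVARIANCE, LIPSCHITZ EDITION** (conclusion = ✓(L23a) `abs_normMean_one_sub_zero_le`). [folklore] -/
theorem abs_normMean_one_sub_zero_le_of_lip {w w' : ℝ → Z → ℝ} {G : Z → ℝ} {U : Set ℝ} (hU : IsOpen U) (hUI : Icc (0:ℝ) 1 ⊆ U)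
    (hG : AEStronglyMeasurable G τ) (hmeas : ∀ s, AEStronglyMeasurable (w s) τ) (hmeas' : ∀ s, AEStronglyMeasurable (w' s) τ)
    (hint : ∀ s ∈ Icc (0:ℝ) 1, Integrable (w s) τ) (hintG : ∀ s ∈ Icc (0:ℝ) 1, Integrable (fun z => G z * w s z) τ)
    {bound : Z → ℝ} (hlip : ∀ᵐ z ∂τ, LipschitzOnWith (Real.nnabs (bound z)) (fun s => w s z) U) (hbint : Integrable bound τ)
    {boundG : Z → ℝ} (hlipG : ∀ᵐ z ∂τ, LipschitzOnWith (Real.nnabs (boundG z)) (fun s => G z * w s z) U) (hbGint : Integrable boundG τ)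
    (hdiff : ∀ s ∈ Icc (0:ℝ) 1, ∀ᵐ z ∂τ, HasDerivAt (fun s => w s z) (w' s z) s)
    (hZ : ∀ s ∈ Icc (0:ℝ) 1, ∫ z, w s z ∂τ ≠ 0) {ℓ : ℝ}
    (hcov : ∀ s ∈ Icc (0:ℝ) 1, |(∫ z, G z * w' s z ∂τ) / (∫ z, w s z ∂τ)
        - ((∫ z, G z * w s z ∂τ) / (∫ z, w s z ∂τ)) * ((∫ z, w' s z ∂τ) / (∫ z, w s z ∂τ))| ≤ ℓ) :
    |(∫ z, G z * w 1 z ∂τ) / (∫ z, w 1 z ∂τ) - (∫ z, G z * w 0 z ∂τ) / (∫ z, w 0 z ∂τ)| ≤ ℓ :=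
  abs_sub_le_of_hasDerivAt_of_abs_le (f := fun s => (∫ z, G z * w s z ∂τ) / (∫ z, w s z ∂τ))
    (fun s hs => hasDerivAt_normMean_of_lip (w'₀ := w' s) (hU.mem_nhds (hUI hs)) hG hmeas (hint s hs) (hintG s hs) (hmeas' s) hlip hbint
      hlipG hbGint (hdiff s hs) (hZ s hs)) hcov

/-- ★★ **LAW EDGE OF A COVARIANCE ≤ sup PATH THIRD CUMULANT, LIPSCHITZ EDITION** (conclusion = ✓(L23a) `abs_normCov_one_sub_zero_le`). [folklore] -/
theorem abs_normCov_one_sub_zero_le_of_lip {w w' : ℝ → Z → ℝ} {A B : Z → ℝ} {U : Set ℝ} (hU : IsOpen U) (hUI : Icc (0:ℝ) 1 ⊆ U)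
    (hA : AEStronglyMeasurable A τ) (hB : AEStronglyMeasurable B τ)
    (hmeas : ∀ s, AEStronglyMeasurable (w s) τ) (hmeas' : ∀ s, AEStronglyMeasurable (w' s) τ)
    (hint : ∀ s ∈ Icc (0:ℝ) 1, Integrable (w s) τ) (hintA : ∀ s ∈ Icc (0:ℝ) 1, Integrable (fun z => A z * w s z) τ)
    (hintB : ∀ s ∈ Icc (0:ℝ) 1, Integrable (fun z => B z * w s z) τ)
    (hintAB : ∀ s ∈ Icc (0:ℝ) 1, Integrable (fun z => (A z * B z) * w s z) τ)
    {bound : Z → ℝ} (hlip : ∀ᵐ z ∂τ, LipschitzOnWith (Real.nnabs (bound z)) (fun s => w s z) U) (hbint : Integrable bound τ)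
    {boundA : Z → ℝ} (hlipA : ∀ᵐ z ∂τ, LipschitzOnWith (Real.nnabs (boundA z)) (fun s => A z * w s z) U) (hbAint : Integrable boundA τ)
    {boundB : Z → ℝ} (hlipB : ∀ᵐ z ∂τ, LipschitzOnWith (Real.nnabs (boundB z)) (fun s => B z * w s z) U) (hbBint : Integrable boundB τ)
    {boundAB : Z → ℝ} (hlipAB : ∀ᵐ z ∂τ, LipschitzOnWith (Real.nnabs (boundAB z)) (fun s => (A z * B z) * w s z) U) (hbABint : Integrable boundAB τ)
    (hdiff : ∀ s ∈ Icc (0:ℝ) 1, ∀ᵐ z ∂τ, HasDerivAt (fun s => w s z) (w' s z) s)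
    (hZ : ∀ s ∈ Icc (0:ℝ) 1, ∫ z, w s z ∂τ ≠ 0) {ℓ : ℝ}
    (hcum : ∀ s ∈ Icc (0:ℝ) 1,
      |((∫ z, (A z * B z) * w' s z ∂τ) / (∫ z, w s z ∂τ)
          - ((∫ z, (A z * B z) * w s z ∂τ) / (∫ z, w s z ∂τ)) * ((∫ z, w' s z ∂τ) / (∫ z, w s z ∂τ)))
        - (((∫ z, A z * w' s z ∂τ) / (∫ z, w s z ∂τ)
              - ((∫ z, A z * w s z ∂τ) / (∫ z, w s z ∂τ)) * ((∫ z, w' s z ∂τ) / (∫ z, w s z ∂τ)))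
            * ((∫ z, B z * w s z ∂τ) / (∫ z, w s z ∂τ))
          + ((∫ z, A z * w s z ∂τ) / (∫ z, w s z ∂τ))
            * ((∫ z, B z * w' s z ∂τ) / (∫ z, w s z ∂τ)
              - ((∫ z, B z * w s z ∂τ) / (∫ z, w s z ∂τ)) * ((∫ z, w' s z ∂τ) / (∫ z, w s z ∂τ))))| ≤ ℓ) :
    |((∫ z, (A z * B z) * w 1 z ∂τ) / (∫ z, w 1 z ∂τ)
        - ((∫ z, A z * w 1 z ∂τ) / (∫ z, w 1 z ∂τ)) * ((∫ z, B z * w 1 z ∂τ) / (∫ z, w 1 z ∂τ)))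
      - ((∫ z, (A z * B z) * w 0 z ∂τ) / (∫ z, w 0 z ∂τ)
        - ((∫ z, A z * w 0 z ∂τ) / (∫ z, w 0 z ∂τ)) * ((∫ z, B z * w 0 z ∂τ) / (∫ z, w 0 z ∂τ)))| ≤ ℓ :=
  abs_sub_le_of_hasDerivAt_of_abs_le
    (f := fun s => (∫ z, (A z * B z) * w s z ∂τ) / (∫ z, w s z ∂τ)
        - ((∫ z, A z * w s z ∂τ) / (∫ z, w s z ∂τ)) * ((∫ z, B z * w s z ∂τ) / (∫ z, w s z ∂τ)))
    (fun s hs => hasDerivAt_normCov_of_lip (w'₀ := w' s) (hU.mem_nhds (hUI hs)) hA hB hmeas (hint s hs) (hintA s hs) (hintB s hs) (hintAB s hs) (hmeas' s)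
      hlip hbint hlipA hbAint hlipB hbBint hlipAB hbABint (hdiff s hs) (hZ s hs)) hcum


/-! ## §3 The law square WITHOUT mixed derivatives, Lipschitz edition -/

/-- ★★ **LAW SQUARE OF A FROZEN-INTEGRAND MEAN ≤ sup OF THE `s′`-EDGE DIFFERENCE OF THE `s`-RESPONSE** (Lipschitz edition; NO mixed family `w₁₂`).  Two-parameter family `w s s′`
with `s`-partial family `w₁`, frozen `G`; for every `s′ ∈ [0,1]`: a.e.-`z` Lipschitz in `s` on an open `U ⊇ [0,1]` of `w(·,s′,z)` and `G·w(·,s′,z)` (integrable constants), and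
`∀ s ∈ [0,1], ∀ᵐ z, HasDerivAt (s ↦ w s s′ z) (w₁ s s′ z) s`; integrability of `w, G·w` and masses `≠ 0` on `[0,1]²`.  KERNEL: `∀ s ∈ [0,1], |D(s,1) − D(s,0)| ≤ ℓ` where
`D(s,s′) := (∫ G·w₁ s s′)∕Z − ((∫ G·w s s′)∕Z)·((∫ w₁ s s′)∕Z)` is the `s`-response at `(s,s′)`.  CONCLUSION: `|ΔΔ_{[0,1]²} (∫ G·w ∕ ∫ w)| ≤ ℓ` (MVT on `g(s) := M(s,1) − M(s,0)`). [folklore] -/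
theorem abs_normMean_secondDiff_le_of_lip {w w₁ : ℝ → ℝ → Z → ℝ} {G : Z → ℝ} {U : Set ℝ} (hU : IsOpen U) (hUI : Icc (0:ℝ) 1 ⊆ U)
    (hG : AEStronglyMeasurable G τ) (hm : ∀ s s', AEStronglyMeasurable (w s s') τ) (hm₁ : ∀ s s', AEStronglyMeasurable (w₁ s s') τ)
    (hi : ∀ s ∈ Icc (0:ℝ) 1, ∀ s' ∈ Icc (0:ℝ) 1, Integrable (w s s') τ)
    (hiG : ∀ s ∈ Icc (0:ℝ) 1, ∀ s' ∈ Icc (0:ℝ) 1, Integrable (fun z => G z * w s s' z) τ)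
    {b₁ : Z → ℝ} (hlip : ∀ s' ∈ Icc (0:ℝ) 1, ∀ᵐ z ∂τ, LipschitzOnWith (Real.nnabs (b₁ z)) (fun s => w s s' z) U) (hb₁i : Integrable b₁ τ)
    {b₁G : Z → ℝ} (hlipG : ∀ s' ∈ Icc (0:ℝ) 1, ∀ᵐ z ∂τ, LipschitzOnWith (Real.nnabs (b₁G z)) (fun s => G z * w s s' z) U) (hb₁Gi : Integrable b₁G τ)
    (hd₁ : ∀ s ∈ Icc (0:ℝ) 1, ∀ s' ∈ Icc (0:ℝ) 1, ∀ᵐ z ∂τ, HasDerivAt (fun s => w s s' z) (w₁ s s' z) s)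
    (hZ : ∀ s ∈ Icc (0:ℝ) 1, ∀ s' ∈ Icc (0:ℝ) 1, ∫ z, w s s' z ∂τ ≠ 0) {ℓ : ℝ}
    (hker : ∀ s ∈ Icc (0:ℝ) 1,
      |((∫ z, G z * w₁ s 1 z ∂τ) / (∫ z, w s 1 z ∂τ) - ((∫ z, G z * w s 1 z ∂τ) / (∫ z, w s 1 z ∂τ)) * ((∫ z, w₁ s 1 z ∂τ) / (∫ z, w s 1 z ∂τ)))
        - ((∫ z, G z * w₁ s 0 z ∂τ) / (∫ z, w s 0 z ∂τ) - ((∫ z, G z * w s 0 z ∂τ) / (∫ z, w s 0 z ∂τ)) * ((∫ z, w₁ s 0 z ∂τ) / (∫ z, w s 0 z ∂τ)))| ≤ ℓ) :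
    |(∫ z, G z * w 1 1 z ∂τ) / (∫ z, w 1 1 z ∂τ) - (∫ z, G z * w 1 0 z ∂τ) / (∫ z, w 1 0 z ∂τ)
      - (∫ z, G z * w 0 1 z ∂τ) / (∫ z, w 0 1 z ∂τ) + (∫ z, G z * w 0 0 z ∂τ) / (∫ z, w 0 0 z ∂τ)| ≤ ℓ := by
  have h1 : (1:ℝ) ∈ Icc (0:ℝ) 1 := ⟨zero_le_one, le_rfl⟩
  have h0 : (0:ℝ) ∈ Icc (0:ℝ) 1 := ⟨le_rfl, zero_le_one⟩
  have hg : ∀ s ∈ Icc (0:ℝ) 1, HasDerivAt (fun s => (∫ z, G z * w s 1 z ∂τ) / (∫ z, w s 1 z ∂τ) - (∫ z, G z * w s 0 z ∂τ) / (∫ z, w s 0 z ∂τ))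
      (((∫ z, G z * w₁ s 1 z ∂τ) / (∫ z, w s 1 z ∂τ) - ((∫ z, G z * w s 1 z ∂τ) / (∫ z, w s 1 z ∂τ)) * ((∫ z, w₁ s 1 z ∂τ) / (∫ z, w s 1 z ∂τ)))
        - ((∫ z, G z * w₁ s 0 z ∂τ) / (∫ z, w s 0 z ∂τ) - ((∫ z, G z * w s 0 z ∂τ) / (∫ z, w s 0 z ∂τ)) * ((∫ z, w₁ s 0 z ∂τ) / (∫ z, w s 0 z ∂τ)))) s := by
    intro s hs
    exact (hasDerivAt_normMean_of_lip (w := fun s => w s 1) (w'₀ := w₁ s 1) (hU.mem_nhds (hUI hs)) hG (fun s => hm s 1) (hi s hs 1 h1) (hiG s hs 1 h1)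
        (hm₁ s 1) (hlip 1 h1) hb₁i (hlipG 1 h1) hb₁Gi (hd₁ s hs 1 h1) (hZ s hs 1 h1)).sub
      (hasDerivAt_normMean_of_lip (w := fun s => w s 0) (w'₀ := w₁ s 0) (hU.mem_nhds (hUI hs)) hG (fun s => hm s 0) (hi s hs 0 h0) (hiG s hs 0 h0)
        (hm₁ s 0) (hlip 0 h0) hb₁i (hlipG 0 h0) hb₁Gi (hd₁ s hs 0 h0) (hZ s hs 0 h0))
  have h := abs_sub_le_of_hasDerivAt_of_abs_le hg hker
  have e : (∫ z, G z * w 1 1 z ∂τ) / (∫ z, w 1 1 z ∂τ) - (∫ z, G z * w 1 0 z ∂τ) / (∫ z, w 1 0 z ∂τ)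
      - ((∫ z, G z * w 0 1 z ∂τ) / (∫ z, w 0 1 z ∂τ) - (∫ z, G z * w 0 0 z ∂τ) / (∫ z, w 0 0 z ∂τ))
      = (∫ z, G z * w 1 1 z ∂τ) / (∫ z, w 1 1 z ∂τ) - (∫ z, G z * w 1 0 z ∂τ) / (∫ z, w 1 0 z ∂τ)
        - (∫ z, G z * w 0 1 z ∂τ) / (∫ z, w 0 1 z ∂τ) + (∫ z, G z * w 0 0 z ∂τ) / (∫ z, w 0 0 z ∂τ) := by ring
  rwa [e] at h

/-! ## §4 The variance square WITHOUT mixed derivatives, Lipschitz edition -/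

/-- ★★ **VARIANCE SQUARE, LIPSCHITZ EDITION** (the (JV4-h′) shape).  Data as in §3 for BOTH frozen factors `Fo` and `Fo·Fo` (Lipschitz binders for `w`, `Fo·w`, `Fo²·w` in `s`
at every `s′ ∈ [0,1]`; a.e. differentiability at each `s`; integrability; masses).  The four path functionals `φ = E[Fo]`, `ψ = E[Fo²]` and their `s`-responses `Dφ`, `Dψ` are
BINDERS with defining equations; KERNEL: `∀ s ∈ [0,1], |(Dψ(s,1) − (Dφ(s,1)·φ(s,1) + φ(s,1)·Dφ(s,1))) − (Dψ(s,0) − (Dφ(s,0)·φ(s,0) + φ(s,0)·Dφ(s,0)))| ≤ ℓ`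
(`Dψ − 2φ·Dφ = Cov_own((Fo − E Fo)², r)` in score language); CONCLUSION `|ΔΔ_{[0,1]²}(ψ − φ²)| ≤ ℓ`. [folklore] -/
theorem abs_normVar_secondDiff_le_of_lip {w w₁ : ℝ → ℝ → Z → ℝ} {Fo : Z → ℝ} {U : Set ℝ} (hU : IsOpen U) (hUI : Icc (0:ℝ) 1 ⊆ U)
    (hFo : AEStronglyMeasurable Fo τ) (hm : ∀ s s', AEStronglyMeasurable (w s s') τ) (hm₁ : ∀ s s', AEStronglyMeasurable (w₁ s s') τ)
    (hi : ∀ s ∈ Icc (0:ℝ) 1, ∀ s' ∈ Icc (0:ℝ) 1, Integrable (w s s') τ)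
    (hiF : ∀ s ∈ Icc (0:ℝ) 1, ∀ s' ∈ Icc (0:ℝ) 1, Integrable (fun z => Fo z * w s s' z) τ)
    (hiFF : ∀ s ∈ Icc (0:ℝ) 1, ∀ s' ∈ Icc (0:ℝ) 1, Integrable (fun z => (Fo z * Fo z) * w s s' z) τ)
    {b₁ : Z → ℝ} (hlip : ∀ s' ∈ Icc (0:ℝ) 1, ∀ᵐ z ∂τ, LipschitzOnWith (Real.nnabs (b₁ z)) (fun s => w s s' z) U) (hb₁i : Integrable b₁ τ)
    {b₁F : Z → ℝ} (hlipF : ∀ s' ∈ Icc (0:ℝ) 1, ∀ᵐ z ∂τ, LipschitzOnWith (Real.nnabs (b₁F z)) (fun s => Fo z * w s s' z) U) (hb₁Fi : Integrable b₁F τ)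
    {b₁FF : Z → ℝ} (hlipFF : ∀ s' ∈ Icc (0:ℝ) 1, ∀ᵐ z ∂τ, LipschitzOnWith (Real.nnabs (b₁FF z)) (fun s => (Fo z * Fo z) * w s s' z) U) (hb₁FFi : Integrable b₁FF τ)
    (hd₁ : ∀ s ∈ Icc (0:ℝ) 1, ∀ s' ∈ Icc (0:ℝ) 1, ∀ᵐ z ∂τ, HasDerivAt (fun s => w s s' z) (w₁ s s' z) s)
    (hZ : ∀ s ∈ Icc (0:ℝ) 1, ∀ s' ∈ Icc (0:ℝ) 1, ∫ z, w s s' z ∂τ ≠ 0)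
    (φ ψ Dφ Dψ : ℝ → ℝ → ℝ)
    (hφ : ∀ s s', φ s s' = (∫ z, Fo z * w s s' z ∂τ) / (∫ z, w s s' z ∂τ))
    (hψ : ∀ s s', ψ s s' = (∫ z, (Fo z * Fo z) * w s s' z ∂τ) / (∫ z, w s s' z ∂τ))
    (hDφ : ∀ s s', Dφ s s' = (∫ z, Fo z * w₁ s s' z ∂τ) / (∫ z, w s s' z ∂τ)
      - ((∫ z, Fo z * w s s' z ∂τ) / (∫ z, w s s' z ∂τ)) * ((∫ z, w₁ s s' z ∂τ) / (∫ z, w s s' z ∂τ)))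
    (hDψ : ∀ s s', Dψ s s' = (∫ z, (Fo z * Fo z) * w₁ s s' z ∂τ) / (∫ z, w s s' z ∂τ)
      - ((∫ z, (Fo z * Fo z) * w s s' z ∂τ) / (∫ z, w s s' z ∂τ)) * ((∫ z, w₁ s s' z ∂τ) / (∫ z, w s s' z ∂τ)))
    {ℓ : ℝ} (hker : ∀ s ∈ Icc (0:ℝ) 1,
      |(Dψ s 1 - (Dφ s 1 * φ s 1 + φ s 1 * Dφ s 1)) - (Dψ s 0 - (Dφ s 0 * φ s 0 + φ s 0 * Dφ s 0))| ≤ ℓ) :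
    |(ψ 1 1 - φ 1 1 * φ 1 1) - (ψ 1 0 - φ 1 0 * φ 1 0) - (ψ 0 1 - φ 0 1 * φ 0 1) + (ψ 0 0 - φ 0 0 * φ 0 0)| ≤ ℓ := by
  have h1 : (1:ℝ) ∈ Icc (0:ℝ) 1 := ⟨zero_le_one, le_rfl⟩
  have h0 : (0:ℝ) ∈ Icc (0:ℝ) 1 := ⟨le_rfl, zero_le_one⟩
  have hFF : AEStronglyMeasurable (fun z => Fo z * Fo z) τ := hFo.mul hFo
  -- the `s`-responses of `φ(·, s′)` and `ψ(·, s′)` at every `s ∈ [0,1]`, `s′ ∈ [0,1]`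
  have dφ : ∀ s ∈ Icc (0:ℝ) 1, ∀ s' ∈ Icc (0:ℝ) 1, HasDerivAt (fun s => φ s s') (Dφ s s') s := by
    intro s hs s' hs'
    have e : (fun s => φ s s') = fun s => (∫ z, Fo z * w s s' z ∂τ) / (∫ z, w s s' z ∂τ) := funext fun s => hφ s s'
    rw [e, hDφ]
    exact hasDerivAt_normMean_of_lip (w := fun s => w s s') (w'₀ := w₁ s s') (hU.mem_nhds (hUI hs)) hFo (fun s => hm s s') (hi s hs s' hs')
      (hiF s hs s' hs') (hm₁ s s') (hlip s' hs') hb₁i (hlipF s' hs') hb₁Fi (hd₁ s hs s' hs') (hZ s hs s' hs')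
  have dψ : ∀ s ∈ Icc (0:ℝ) 1, ∀ s' ∈ Icc (0:ℝ) 1, HasDerivAt (fun s => ψ s s') (Dψ s s') s := by
    intro s hs s' hs'
    have e : (fun s => ψ s s') = fun s => (∫ z, (Fo z * Fo z) * w s s' z ∂τ) / (∫ z, w s s' z ∂τ) := funext fun s => hψ s s'
    rw [e, hDψ]
    exact hasDerivAt_normMean_of_lip (w := fun s => w s s') (w'₀ := w₁ s s') (hU.mem_nhds (hUI hs)) hFF (fun s => hm s s') (hi s hs s' hs')
      (hiFF s hs s' hs') (hm₁ s s') (hlip s' hs') hb₁i (hlipFF s' hs') hb₁FFi (hd₁ s hs s' hs') (hZ s hs s' hs')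
  have hg : ∀ s ∈ Icc (0:ℝ) 1, HasDerivAt (fun s => (ψ s 1 - φ s 1 * φ s 1) - (ψ s 0 - φ s 0 * φ s 0))
      ((Dψ s 1 - (Dφ s 1 * φ s 1 + φ s 1 * Dφ s 1)) - (Dψ s 0 - (Dφ s 0 * φ s 0 + φ s 0 * Dφ s 0))) s := by
    intro s hs
    exact ((dψ s hs 1 h1).sub ((dφ s hs 1 h1).mul (dφ s hs 1 h1))).sub ((dψ s hs 0 h0).sub ((dφ s hs 0 h0).mul (dφ s hs 0 h0)))
  have h := abs_sub_le_of_hasDerivAt_of_abs_le hg hker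
  have e : (ψ 1 1 - φ 1 1 * φ 1 1) - (ψ 1 0 - φ 1 0 * φ 1 0) - ((ψ 0 1 - φ 0 1 * φ 0 1) - (ψ 0 0 - φ 0 0 * φ 0 0))
      = (ψ 1 1 - φ 1 1 * φ 1 1) - (ψ 1 0 - φ 1 0 * φ 1 0) - (ψ 0 1 - φ 0 1 * φ 0 1) + (ψ 0 0 - φ 0 0 * φ 0 0) := by ring
  rwa [e] at h

end Summit.QuantumFields.YangMills.Theorems.OrganTangentLawResponseLip

end
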